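import Mathlib
import Summits.CriticalPhenomena.PercolationContinuityZ3.Theorems.PercNearOneGluingNoHeavyLowerTailThreeFamilyTripleMinus

/-!
# Three-family count with an ORDERED middle family (`A′` from dimension hypotheses; ordered Marica–Schönheim mechanism)

Helper file for crux `stmt-CriticalPhenomena-4575` (`NoHeavyLowerTail`, route `PercNearOneGluingNoHeavy`),
new-inequality factory seat `prim-ineq-gen-3` (gen 11).  Everything in this file is PROVED.

The three-family count `#P + #Q + #R ≤ #G` of `ThreeFamilyRank.card_add_card_add_card_le_of_blocks` (Theorem A′ +
TRIPLE⁻, gens 9–10) asks that ALL within-family differences of each family lie in the down-closed family `G`; this is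
used only to get `finrank V_T = #T` (plain vectors of one family are linearly independent).  For the MIDDLE family `Q`
the rigidity theorem TRIPLE⁻ does not need `Q \\ Q ⊆ G` at all, and linear independence of the plain vectors of `Q`
already follows from an ORDERED difference condition (the mechanism of the ordered Marica–Schönheim inequality, gen 5):
if `Q = Q₁ ∪ Q₂` with `Q₁ \\ Q₁, Q₂ \\ Q₂, Q₁ \\ Q₂ ⊆ G` and no member of `Q₁` contained in a member of `Q₂`, then
`finrank V_Q = #Q` (`finrank_V_union`; test a relation against the coplain vector of a minimal member of `Q₂` carrying a
nonzero coefficient, or of `Q₁` if there is none).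

* `card_add_card_add_card_le_of_finrank` — Theorem A′ with the three dimension equalities as hypotheses.
* `finrank_V_union` — the ordered independence lemma.
* `card_add_card_add_card_le_of_blocks_ordered` — `#P + #(Q₁ ∪ Q₂) + #R ≤ #G` for pairwise cross-intersecting
  `P, Q₁ ∪ Q₂, R` with `P ∩ R = ∅`, `G` down-closed containing `P \\ P`, `R \\ R`, `Q₁ \\ Q₁`, `Q₂ \\ Q₂`, `Q₁ \\ Q₂`,
  all cross meets and the two outer double-difference blocks, and no member of `Q₁` inside a member of `Q₂`.

Application (file `…OrientedAntipodalHallOrderedAssignment.lean`): in the master three-group Hall count the middle group may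
now mix complemented and plain classes; on four petals this covers 33 of the 41 opposite-free type classes (29 before),
including the smallest previously open class `{(0,1),(0,2),(1,2),(3,0)}` (memo prim-ineq-gen-3/FINDINGS-gen11.md).
(prim-ineq-gen-3 gen 11, 2026-08-20.)
-/

namespace Summit.CriticalPhenomena.PercolationContinuityZ3.Theorems

namespace ThreeFamilyRank

open Finset Module

variable {α : Type*} [DecidableEq α]

/-- The testing step of the Marica–Schönheim mechanism: a linear combination of plain vectors in which some member `X₀`
with nonzero coefficient sees every other member `i` with nonzero coefficient through a difference `i \ X₀ ∈ G` and is
not a proper superset of any of them, is nonzero (pair it with the coplain vector of `X₀`). -/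
theorem sum_smul_chi_ne_zero (G : Finset (Finset α)) (hG : ∀ E ∈ G, ∀ F, F ⊆ E → F ∈ G)
    (P : Finset (Finset α)) (s : Finset ↥P) (g : ↥P → ℚ) (X₀ : ↥P) (hX₀ : X₀ ∈ s) (hg₀ : g X₀ ≠ 0)
    (hw : ∀ i ∈ s, g i ≠ 0 → ((i : Finset α) \ (X₀ : Finset α) ∈ G ∧ ((i : Finset α) ⊆ X₀ → i = X₀))) :
    ∑ i ∈ s, g i • chi G (i : Finset α) ≠ 0 := by
  intro hsum
  have h0 : sform G (∑ i ∈ s, g i • chi G (i : Finset α)) (cochi G X₀) = 0 := by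
    rw [hsum, LinearMap.map_zero, LinearMap.zero_apply]
  rw [map_sum, LinearMap.sum_apply] at h0
  simp only [LinearMap.map_smul, LinearMap.smul_apply, smul_eq_mul] at h0
  have h1 : ∀ i ∈ s, g i * sform G (chi G (i : Finset α)) (cochi G X₀) =
      if i = X₀ then g X₀ else 0 := by
    intro i hi
    by_cases hgi : g i = 0
    · by_cases hiX : i = X₀
      · exact absurd (hiX ▸ hgi) hg₀
      · rw [hgi, zero_mul, if_neg hiX]
    · obtain ⟨hdiff, hsub⟩ := hw i hi hgi
      rw [sform_chi_cochi G hG hdiff]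
      by_cases hiX : i = X₀
      · subst hiX; simp
      · rw [if_neg hiX]
        have hns : ¬ (i : Finset α) ⊆ X₀ := fun h => hiX (hsub h)
        simp [hns]
  rw [Finset.sum_congr rfl h1, Finset.sum_ite_eq' s X₀, if_pos hX₀] at h0
  exact hg₀ h0

/-- **Ordered independence.**  If `P₁ \\ P₁, P₂ \\ P₂, P₁ \\ P₂ ⊆ G` (`G` down-closed) and no member of `P₁` is contained in
a member of `P₂`, the plain vectors of `P₁ ∪ P₂` are linearly independent in `ℚ^G`.  (Ordered Marica–Schönheim mechanism:
the differences `P₂ \\ P₁` are NOT needed.) -/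
theorem linearIndependent_chi_union (G : Finset (Finset α)) (hG : ∀ E ∈ G, ∀ F, F ⊆ E → F ∈ G)
    (P₁ P₂ : Finset (Finset α))
    (h₁₁ : ∀ X ∈ P₁, ∀ X' ∈ P₁, X \ X' ∈ G) (h₂₂ : ∀ X ∈ P₂, ∀ X' ∈ P₂, X \ X' ∈ G)
    (h₁₂ : ∀ X ∈ P₁, ∀ X' ∈ P₂, X \ X' ∈ G ∧ ¬ X ⊆ X') :
    LinearIndependent ℚ (fun X : ↥(P₁ ∪ P₂) => chi G (X : Finset α)) := by
  rw [linearIndependent_iff']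
  intro s g hsum
  by_contra hcon
  set N : Finset ↥(P₁ ∪ P₂) := s.filter fun i => g i ≠ 0 with hN
  have hNne : N.Nonempty := by
    by_contra h'
    rw [Finset.not_nonempty_iff_eq_empty, Finset.filter_eq_empty_iff] at h'
    exact hcon fun i hi => by simpa using h' hi
  by_cases h2 : (N.filter (fun i : ↥(P₁ ∪ P₂) => (i : Finset α) ∈ P₂)).Nonempty
  · -- a minimal member of `P₂` with nonzero coefficient
    obtain ⟨X₀, hX₀, hmin⟩ := Finset.exists_min_image (N.filter (fun i : ↥(P₁ ∪ P₂) => (i : Finset α) ∈ P₂))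
      (fun i => #(i : Finset α)) h2
    rw [Finset.mem_filter] at hX₀
    have hX₀N := Finset.mem_filter.mp hX₀.1
    refine sum_smul_chi_ne_zero G hG (P₁ ∪ P₂) s g X₀ hX₀N.1 hX₀N.2 (fun i hi hgi => ?_) hsum
    by_cases hi2 : (i : Finset α) ∈ P₂
    · refine ⟨h₂₂ _ hi2 _ hX₀.2, fun hsub => ?_⟩
      by_contra hne
      have hne' : (i : Finset α) ≠ X₀ := fun h => hne (Subtype.ext h)
      have hlt : #(i : Finset α) < #(X₀ : Finset α) := Finset.card_lt_card (lt_of_le_of_ne hsub hne')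
      have hiN : i ∈ N.filter (fun i : ↥(P₁ ∪ P₂) => (i : Finset α) ∈ P₂) :=
        Finset.mem_filter.mpr ⟨Finset.mem_filter.mpr ⟨hi, hgi⟩, hi2⟩
      exact absurd (hmin i hiN) (not_le.mpr hlt)
    · have hi1 : (i : Finset α) ∈ P₁ := by
        rcases Finset.mem_union.mp i.2 with h | h
        · exact h
        · exact absurd h hi2
      obtain ⟨hd, hns⟩ := h₁₂ _ hi1 _ hX₀.2
      exact ⟨hd, fun hsub => absurd hsub hns⟩
  · -- all nonzero coefficients sit on `P₁`
    have hall1 : ∀ i ∈ s, g i ≠ 0 → (i : Finset α) ∈ P₁ := by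
      intro i hi hgi
      rcases Finset.mem_union.mp i.2 with h | h
      · exact h
      · exact absurd ⟨i, Finset.mem_filter.mpr ⟨Finset.mem_filter.mpr ⟨hi, hgi⟩, h⟩⟩ h2
    obtain ⟨X₀, hX₀, hmin⟩ := Finset.exists_min_image N (fun i => #(i : Finset α)) hNne
    have hX₀N := Finset.mem_filter.mp hX₀
    have hX₀1 : (X₀ : Finset α) ∈ P₁ := hall1 X₀ hX₀N.1 hX₀N.2
    refine sum_smul_chi_ne_zero G hG (P₁ ∪ P₂) s g X₀ hX₀N.1 hX₀N.2 (fun i hi hgi => ?_) hsum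
    refine ⟨h₁₁ _ (hall1 i hi hgi) _ hX₀1, fun hsub => ?_⟩
    by_contra hne
    have hne' : (i : Finset α) ≠ X₀ := fun h => hne (Subtype.ext h)
    have hlt : #(i : Finset α) < #(X₀ : Finset α) := Finset.card_lt_card (lt_of_le_of_ne hsub hne')
    exact absurd (hmin i (Finset.mem_filter.mpr ⟨hi, hgi⟩)) (not_le.mpr hlt)

/-- Hence `finrank V_{P₁ ∪ P₂} = #(P₁ ∪ P₂)` under the ordered difference condition. -/
theorem finrank_V_union (G : Finset (Finset α)) (hG : ∀ E ∈ G, ∀ F, F ⊆ E → F ∈ G)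
    (P₁ P₂ : Finset (Finset α))
    (h₁₁ : ∀ X ∈ P₁, ∀ X' ∈ P₁, X \ X' ∈ G) (h₂₂ : ∀ X ∈ P₂, ∀ X' ∈ P₂, X \ X' ∈ G)
    (h₁₂ : ∀ X ∈ P₁, ∀ X' ∈ P₂, X \ X' ∈ G ∧ ¬ X ⊆ X') :
    finrank ℚ (V G (P₁ ∪ P₂)) = #(P₁ ∪ P₂) := by
  rw [V, finrank_span_eq_card (linearIndependent_chi_union G hG P₁ P₂ h₁₁ h₂₂ h₁₂)]
  simp

/-- **Theorem A′ from dimension hypotheses.**  For three pairwise cross-intersecting families `P, Q, R` whose cross meets lie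
in the down-closed `G` and whose plain vectors span subspaces of the full dimensions `#P, #Q, #R`,
`#P + #Q + #R ≤ #G + finrank (V_P ⊓ V_Q ⊓ V_R)`.  (Same proof as `card_add_card_add_card_le`.) -/
theorem card_add_card_add_card_le_of_finrank (G : Finset (Finset α)) (hG : ∀ E ∈ G, ∀ F, F ⊆ E → F ∈ G)
    (P Q R : Finset (Finset α))
    (hP : finrank ℚ (V G P) = #P) (hQ : finrank ℚ (V G Q) = #Q) (hR : finrank ℚ (V G R) = #R)
    (hPQ : ∀ X ∈ P, ∀ Y ∈ Q, X ∩ Y ∈ G ∧ (X ∩ Y).Nonempty)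
    (hQR : ∀ Y ∈ Q, ∀ Z ∈ R, Y ∩ Z ∈ G ∧ (Y ∩ Z).Nonempty)
    (hRP : ∀ Z ∈ R, ∀ X ∈ P, Z ∩ X ∈ G ∧ (Z ∩ X).Nonempty) :
    #P + #Q + #R ≤ #G + finrank ℚ ↥(V G P ⊓ V G Q ⊓ V G R) := by
  have hQP : ∀ Y ∈ Q, ∀ X ∈ P, Y ∩ X ∈ G ∧ (Y ∩ X).Nonempty := fun Y hY X hX => by
    rw [Finset.inter_comm]; exact hPQ X hX Y hY
  have hRQ : ∀ Z ∈ R, ∀ Y ∈ Q, Z ∩ Y ∈ G ∧ (Z ∩ Y).Nonempty := fun Z hZ Y hY => by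
    rw [Finset.inter_comm]; exact hQR Y hY Z hZ
  have hPR : ∀ X ∈ P, ∀ Z ∈ R, X ∩ Z ∈ G ∧ (X ∩ Z).Nonempty := fun X hX Z hZ => by
    rw [Finset.inter_comm]; exact hRP Z hZ X hX
  have hA : V G P ⊓ V G Q ≤ (sform G).orthogonal (V G P ⊔ V G Q ⊔ V G R) := by
    intro w hw
    rw [Submodule.mem_inf] at hw
    refine mem_orthogonal_of_forall G (fun X hX => ?_) (fun Y hY => ?_) (fun Z hZ => ?_)
    · exact V_le_ker_sform_chi G hG (hPQ X hX) hw.2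
    · exact V_le_ker_sform_chi G hG (hQP Y hY) hw.1
    · exact V_le_ker_sform_chi G hG (hRP Z hZ) hw.1
  have hB : (V G P ⊔ V G Q) ⊓ V G R ≤ (sform G).orthogonal (V G P ⊔ V G Q ⊔ V G R) := by
    intro w hw
    rw [Submodule.mem_inf] at hw
    refine mem_orthogonal_of_forall G (fun X hX => ?_) (fun Y hY => ?_) (fun Z hZ => ?_)
    · exact V_le_ker_sform_chi G hG (hPR X hX) hw.2
    · exact V_le_ker_sform_chi G hG (hQR Y hY) hw.2
    · have hle : V G P ⊔ V G Q ≤ LinearMap.ker (sform G (chi G Z)) :=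
        sup_le (V_le_ker_sform_chi G hG (hRP Z hZ)) (V_le_ker_sform_chi G hG (hRQ Z hZ))
      exact hle hw.1
  have h1 := Submodule.finrank_sup_add_finrank_inf_eq (V G P) (V G Q)
  have h2 := Submodule.finrank_sup_add_finrank_inf_eq (V G P ⊔ V G Q) (V G R)
  have h3 := Submodule.finrank_sup_add_finrank_inf_eq (V G P ⊓ V G Q) ((V G P ⊔ V G Q) ⊓ V G R)
  have h4 : finrank ℚ ↥((V G P ⊓ V G Q) ⊔ ((V G P ⊔ V G Q) ⊓ V G R)) ≤
      finrank ℚ ↥((sform G).orthogonal (V G P ⊔ V G Q ⊔ V G R)) :=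
    Submodule.finrank_mono (sup_le hA hB)
  have h5 : finrank ℚ ↥((V G P ⊓ V G Q) ⊓ ((V G P ⊔ V G Q) ⊓ V G R)) ≤
      finrank ℚ ↥(V G P ⊓ V G Q ⊓ V G R) := by
    apply Submodule.finrank_mono
    intro w hw
    simp only [Submodule.mem_inf] at hw ⊢
    exact ⟨⟨hw.1.1, hw.1.2⟩, hw.2.2⟩
  have h6 := LinearMap.BilinForm.finrank_orthogonal (sform_nondegenerate G) (V G P ⊔ V G Q ⊔ V G R)
  have h7 := finrank_Vec G
  have h8 : finrank ℚ ↥(V G P ⊔ V G Q ⊔ V G R) ≤ finrank ℚ (Vec G) := Submodule.finrank_le _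
  omega

/-- **Three-family count with an ordered middle family.**  `P`, `Q₁ ∪ Q₂`, `R` pairwise cross-intersecting families of
subsets of `S`, no set in both `P` and `R`; `G` down-closed in `S` containing `P \\ P`, `R \\ R`, `Q₁ \\ Q₁`, `Q₂ \\ Q₂`,
`Q₁ \\ Q₂`, all cross meets and the outer double differences `X \ (Y ∪ Z)`, `Z \ (X ∪ Y)`; no member of `Q₁` is contained in
a member of `Q₂`.  Then `#P + #(Q₁ ∪ Q₂) + #R ≤ #G`.  (A′ from dimensions + ordered independence + TRIPLE⁻; the
differences `Q₂ \\ Q₁` are not needed.) -/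
theorem card_add_card_add_card_le_of_blocks_ordered (S : Finset α) (G P Q₁ Q₂ R : Finset (Finset α))
    (hGS : ∀ E ∈ G, E ⊆ S) (hG : ∀ E ∈ G, ∀ F, F ⊆ E → F ∈ G)
    (hPS : ∀ U ∈ P, U ⊆ S) (hQS : ∀ U ∈ Q₁ ∪ Q₂, U ⊆ S) (hRS : ∀ U ∈ R, U ⊆ S)
    (hPP : ∀ X ∈ P, ∀ X' ∈ P, X \ X' ∈ G)
    (hQ₁₁ : ∀ Y ∈ Q₁, ∀ Y' ∈ Q₁, Y \ Y' ∈ G) (hQ₂₂ : ∀ Y ∈ Q₂, ∀ Y' ∈ Q₂, Y \ Y' ∈ G)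
    (hQ₁₂ : ∀ Y ∈ Q₁, ∀ Y' ∈ Q₂, Y \ Y' ∈ G ∧ ¬ Y ⊆ Y')
    (hRR : ∀ Z ∈ R, ∀ Z' ∈ R, Z \ Z' ∈ G)
    (hPQ : ∀ X ∈ P, ∀ Y ∈ Q₁ ∪ Q₂, X ∩ Y ∈ G ∧ (X ∩ Y).Nonempty)
    (hQR : ∀ Y ∈ Q₁ ∪ Q₂, ∀ Z ∈ R, Y ∩ Z ∈ G ∧ (Y ∩ Z).Nonempty)
    (hRP : ∀ Z ∈ R, ∀ X ∈ P, Z ∩ X ∈ G ∧ (Z ∩ X).Nonempty)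
    (hDDP : ∀ X ∈ P, ∀ Y ∈ Q₁ ∪ Q₂, ∀ Z ∈ R, X \ (Y ∪ Z) ∈ G)
    (hDDR : ∀ X ∈ P, ∀ Y ∈ Q₁ ∪ Q₂, ∀ Z ∈ R, Z \ (X ∪ Y) ∈ G)
    (hdisj : ∀ U ∈ P, U ∉ R) :
    #P + #(Q₁ ∪ Q₂) + #R ≤ #G := by
  have hP := finrank_V G hG P hPP
  have hQ := finrank_V_union G hG Q₁ Q₂ hQ₁₁ hQ₂₂ hQ₁₂
  have hR := finrank_V G hG R hRR
  have htriple := V_inf_V_inf_V_eq_bot_of_blocks S G P (Q₁ ∪ Q₂) R hGS hG hPS hQS hRS hPP hRR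
    (fun X hX Y hY => (hPQ X hX Y hY).1) (fun Y hY Z hZ => (hQR Y hY Z hZ).1) hDDP hDDR hdisj
  have h := card_add_card_add_card_le_of_finrank G hG P (Q₁ ∪ Q₂) R hP hQ hR hPQ hQR hRP
  rw [htriple, finrank_bot] at h
  simpa using h

end ThreeFamilyRank

end Summit.CriticalPhenomena.PercolationContinuityZ3.Theorems
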